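import Summits.CriticalPhenomena.PercolationContinuityZ3.Theses.PercNonProliferation

/-!
# Sketch — crux-ideate stmt-CriticalPhenomena-4446 (`SubpolynomialBlocking`), round 1, ideator 3

First lemmas of the two idea cards `cross-sandwich-flat-seal` and `root-trick-wall-patch`.
Everything is stated over existing declarations (`box`, `innerBoundary`, `openConnIn`,
`bondPercolation`, `zdGraph`, `criticalProbI`); proofs are `sorry` (ideation stage: the lemmas must
elaborate, not be proved). Coordinate `0` is the "vertical"/normal direction throughout, matching
`Literature.Probability.Percolation.halfSpace d = {x | 0 ≤ x 0}`.
-/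

namespace Summit.CriticalPhenomena.PercolationContinuityZ3.Cruxes.SubpolynomialBlocking.Ideator3

open Literature.Probability.LatticeModels Literature.Probability.Percolation MeasureTheory Filter

noncomputable section

/-- The critical bond measure on `ℤ³`. -/
abbrev μc : Measure (BondConfig (Site 3)) := bondPercolation (zdGraph 3) (criticalProbI 3)

/-- Coordinate box `{x | ∀ i, a i ≤ x i ≤ b i}`. -/
def cbox (a b : Site 3) : Set (Site 3) := {x | ∀ i, a i ≤ x i ∧ x i ≤ b i}

/-- The crux's event: the annulus `Λ_{2n} ∖ Λ_n` is blocked (no open path inside `Λ_{2n}` from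
`Λ_n` to `∂⁻Λ_{2n}`). Verbatim the set appearing in `SubpolynomialBlocking`. -/
def blockEvt (n : ℕ) : Set (BondConfig (Site 3)) :=
  {ω | ¬ ∃ x ∈ box 3 n, ∃ y ∈ innerBoundary (zdGraph 3) (box 3 (2 * n)),
      ω ∈ openConnIn ↑(box 3 (2 * n)) x y}

/-- `u_n := P_{p_c}(blockEvt n)`, the critical annulus-blocking probability. -/
def u (n : ℕ) : ℝ := μc.real (blockEvt n)

/-- The crux is literally `∀ s > 0, eventually n^{-s} ≤ u n`. -/
theorem subpolynomialBlocking_iff :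
    Theses.PercNonProliferation.SubpolynomialBlocking ↔
      ∀ s : ℝ, 0 < s → ∀ᶠ n : ℕ in atTop, (n : ℝ) ^ (-s) ≤ u n :=
  Iff.rfl

/-- SEALING EVENT of the coordinate box `cbox a b` in direction `i`: no open path inside the box
joins its face `{x i = a i}` to its face `{x i = b i}` (a closed dual plaquette sheet separates the
two faces). Decreasing event. -/
def sealEvt (a b : Site 3) (i : Fin 3) : Set (BondConfig (Site 3)) :=
  {ω | ¬ ∃ x ∈ cbox a b, ∃ y ∈ cbox a b, x i = a i ∧ y i = b i ∧ ω ∈ openConnIn (cbox a b) x y}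

/-! ### Card `cross-sandwich-flat-seal`: the six-column / six-slab sandwich -/

/-- Lower corner of the TOP FACE-COLUMN `C_top(n) = [n,2n] × [-(n-1), n-1]²` above `Λ_n`
(vertical coordinate `0`). The six face-columns (images of `C_top` under the lattice symmetries
fixing `Λ_n`) are pairwise vertex-disjoint. -/
def colLo (n : ℕ) : Site 3 := ![(n : ℤ), -((n : ℤ) - 1), -((n : ℤ) - 1)]
/-- Upper corner of the top face-column. -/
def colHi (n : ℕ) : Site 3 := ![2 * (n : ℤ), (n : ℤ) - 1, (n : ℤ) - 1]

/-- Lower corner of the TOP FACE-SLAB `S_top(n) = [n,2n] × [-2n,2n]²` of the annulus. -/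
def slabLo (n : ℕ) : Site 3 := ![(n : ℤ), -(2 * (n : ℤ)), -(2 * (n : ℤ))]
/-- Upper corner of the top face-slab. -/
def slabHi (n : ℕ) : Site 3 := ![2 * (n : ℤ), 2 * (n : ℤ), 2 * (n : ℤ)]

/-- `W n`: sealing probability of the face-column (a `(2n-1) × (2n-1) × (n+1)`-vertex flat box
sealed across its thin direction). -/
def W (n : ℕ) : ℝ := μc.real (sealEvt (colLo n) (colHi n) 0)

/-- `V n`: sealing probability of the face-slab (a `(4n+1) × (4n+1) × (n+1)` flat box sealed
across its thin direction) — the `w_j` of card dyadic-shell-borel-cantelli. -/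
def V (n : ℕ) : ℝ := μc.real (sealEvt (slabLo n) (slabHi n) 0)

/-- (S1) deterministic: a blocked annulus seals the top face-column — a vertical open crossing of
`C_top(n)` inside `C_top(n) ⊆ Λ_{2n}` starts on the top layer of `Λ_n` and ends on `∂⁻Λ_{2n}`. -/
theorem blockEvt_subset_seal_col (n : ℕ) (hn : 1 ≤ n) :
    blockEvt n ⊆ sealEvt (colLo n) (colHi n) 0 := by
  sorry

/-- (S2) UPPER SANDWICH `u_n ≤ W_n⁶`: `blockEvt n ⊆ ⋂ (six face-columns sealed)`; the six columns
are pairwise vertex-disjoint, so the six sealing events are independent and equiprobable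
(coordinate permutations / reflections preserve `bondPercolation (zdGraph 3) p`). -/
theorem u_le_W_pow_six (n : ℕ) (hn : 1 ≤ n) : u n ≤ W n ^ 6 := by
  sorry

/-- (S3) LOWER SANDWICH `V_n⁶ ≤ u_n` (last-exit: an annulus crossing ending on the top face of
`∂⁻Λ_{2n}` contains, after its last visit to height `≤ n`, a vertical crossing of `S_top(n)` inside
`S_top(n)`; Harris–FKG `harris_fkg_lower` for the six decreasing slab-sealing events). -/
theorem V_pow_six_le_u (n : ℕ) : V n ^ 6 ≤ u n := by
  sorry

/-- (S4) TILING (Union Lemma of card blockers-glue-tassion-on-cutsets + Harris): the face-slab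
seal is a bounded product of face-column-shaped seals at the same scale, so `V_n ≥ W_n^{K₀}` for
an absolute `K₀` (here recorded with the unoptimised `K₀ = 60`). -/
theorem W_pow_le_V (n : ℕ) (hn : 1 ≤ n) : W n ^ 60 ≤ V n := by
  sorry

/-- Flat-box form of the crux: the `2:2:1` column seal decays slower than any power. -/
def FlatSealSubpoly : Prop := ∀ s : ℝ, 0 < s → ∀ᶠ n : ℕ in atTop, (n : ℝ) ^ (-s) ≤ W n

/-- (S5) TRANSFER (exact): `SubpolynomialBlocking ↔ FlatSealSubpoly`, from (S2)–(S4)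
(`n^{-s} ≤ u ≤ W⁶` gives `W ≥ n^{-s/6}`; `W ≥ n^{-s/360}` gives `u ≥ V⁶ ≥ W^{360} ≥ n^{-s}`). -/
theorem subpolynomialBlocking_iff_flatSeal :
    Theses.PercNonProliferation.SubpolynomialBlocking ↔ FlatSealSubpoly := by
  sorry

/-! ### Card `root-trick-wall-patch`: half-space patch enclosure -/

/-- The wall patch `P_r = {0} × [0,r)²` on the wall `{x 0 = 0}` of the half-space `{0 ≤ x 0}`. -/
def patch (r : ℕ) : Set (Site 3) := {x | x 0 = 0 ∧ 0 ≤ x 1 ∧ x 1 < r ∧ 0 ≤ x 2 ∧ x 2 < r}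

/-- `H ∩ B⁺(P_r, 4r)`: the points of the half-space at sup-distance `≤ 4r` from the patch. -/
def hsBall (r : ℕ) : Set (Site 3) :=
  cbox ![0, -(4 * (r : ℤ)), -(4 * (r : ℤ))] ![4 * (r : ℤ), 5 * (r : ℤ) - 1, 5 * (r : ℤ) - 1]

/-- The far boundary `H ∩ S(P_r, 4r)`: points of `hsBall r` at sup-distance exactly `4r` from the
patch (depth `4r`, or lateral offset `4r`). -/
def farFace (r : ℕ) : Set (Site 3) :=
  {y | y ∈ hsBall r ∧ (y 0 = 4 * (r : ℤ) ∨ y 1 = -(4 * (r : ℤ)) ∨ y 1 = 5 * (r : ℤ) - 1 ∨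
      y 2 = -(4 * (r : ℤ)) ∨ y 2 = 5 * (r : ℤ) - 1)}

/-- HALF-SPACE PATCH ENCLOSURE `HS(r, 4r)`: no open path inside `H ∩ B⁺(P_r,4r)` joins the wall
patch `P_r` to sup-distance `4r`. For FIXED `r` its probability tends to one along `4r → ∞`
(Barsky–Grimmett–Newman, `BarskyGrimmettNewman1991_Z3`); the card asks for it at the patch's
own scale. Decreasing event. -/
def hsEvt (r : ℕ) : Set (BondConfig (Site 3)) :=
  {ω | ¬ ∃ x ∈ patch r, ∃ y ∈ farFace r, ω ∈ openConnIn (hsBall r) x y}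

/-- `h r := P_{p_c}(HS(r,4r))`. -/
def h (r : ℕ) : ℝ := μc.real (hsEvt r)

/-- The `2:2:1` flat box `F_r = [0,5r] × [0,10r-1]²` hanging from the wall `{x 0 = 0}`; its
wall face is tiled by the `100` translates `P_r + (0, ar, br)`, `a b < 10`. -/
def flatLo (_r : ℕ) : Site 3 := ![0, 0, 0]
/-- Upper corner of `F_r`. -/
def flatHi (r : ℕ) : Site 3 := ![5 * (r : ℤ), 10 * (r : ℤ) - 1, 10 * (r : ℤ) - 1]

/-- (R1) ROOT-TRICK / SHIELD INEQUALITY: `P(F_r sealed across its thin direction) ≥ h(r)^{100}`.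
Proof shape: `seal(F_r) = ⋂_{t} Shield(t)` over the 100 wall cells `t` (no open path inside `F_r`
from the deep face `{x 0 = 5r}` to `t`); `Shield(t) ⊇ LocalShield(t)` (a deep-face-to-`t` path
enters `B⁺(t,4r)` across `S(t,4r)`, last-entrance) `⊇` the translate of `hsEvt r`
(`F_r ∩ B⁺(t,4r) ⊆ H ∩ B⁺(t,4r)`: fewer vertices, fewer paths); Harris–FKG for the 100 decreasing
events and translation invariance (`bondPercolation_real_preimage_shift`). -/
theorem h_pow_le_seal_flat (r : ℕ) (hr : 1 ≤ r) :
    h r ^ 100 ≤ μc.real (sealEvt (flatLo r) (flatHi r) 0) := by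
  sorry

/-- Mesoscopic-BGN form of the crux. -/
def WallPatchEnclosureSubpoly : Prop := ∀ s : ℝ, 0 < s → ∀ᶠ r : ℕ in atTop, (r : ℝ) ^ (-s) ≤ h r

/-- (R2) TRANSFER (exact up to bounded rescaling and fixed powers):
`SubpolynomialBlocking ↔ WallPatchEnclosureSubpoly`. `←`: (R1) + reshaping `F_r` to the
face-column/slab shapes by the Union-Lemma tiling + (S3). `→`: `hsEvt r ⊇` the intersection of the
five far-face slab seals of `hsBall r` (last-exit), each a flat-box seal at scale `≍ r`, `≥` powers
of `W` by tiling, and `W ≥ u^{1/6}` by (S2). -/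
theorem subpolynomialBlocking_iff_wallPatch :
    Theses.PercNonProliferation.SubpolynomialBlocking ↔ WallPatchEnclosureSubpoly := by
  sorry

/-- (R3) The Harris-product floor and why it is not enough: `h(r) ≥ (1 - π_H(3r))^{r²}` where
`π_H(m)` is the critical wall one-arm probability to sup-distance `m` inside the half-space
(each of the `r²` patch points separately fails to reach `farFace r`; Harris–FKG). Recorded as the
inequality `h r ≥ (μc.real (one wall point does not reach sup-distance 3r in H))^(r^2)`. -/
theorem harris_floor (r : ℕ) (hr : 1 ≤ r) :
    (μc.real {ω | ¬ ∃ y ∈ cbox ![0, -(3 * (r : ℤ)), -(3 * (r : ℤ))] ![3 * (r : ℤ), 3 * (r : ℤ), 3 * (r : ℤ)],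
        (y 0 = 3 * (r : ℤ) ∨ y 1 = -(3 * (r : ℤ)) ∨ y 1 = 3 * (r : ℤ) ∨ y 2 = -(3 * (r : ℤ)) ∨ y 2 = 3 * (r : ℤ)) ∧
        ω ∈ openConnIn (cbox ![0, -(3 * (r : ℤ)), -(3 * (r : ℤ))] ![3 * (r : ℤ), 3 * (r : ℤ), 3 * (r : ℤ)]) 0 y})
      ^ (r ^ 2) ≤ h r := by
  sorry

end

end Summit.CriticalPhenomena.PercolationContinuityZ3.Cruxes.SubpolynomialBlocking.Ideator3
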